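import Literature.RepresentationTheory.Kovacevic2021.SU21GaugeExistence
import Literature.RepresentationTheory.Kovacevic2021.SU21CohomologicalClassification
import Literature.RepresentationTheory.Kovacevic2021.SU21Irreducible
import HarnessLib

/-!
# An irreducible cohomological `K`-type datum for `SU(2,1)` is isomorphic to one of the six model modules
# (Borel–Wallach VI Thm 4.11 (1) "`V ∈ Π^ρ(G)`", datum form, up to isomorphism of `𝔤𝔩(3,ℂ)`-modules)

Continuation of `Literature.RepresentationTheory.Kovacevic2021.SU21CohomologicalClassification` (an irreducible
datum `𝒟` with `dim H^q(𝔤𝔩₃, 𝔨; V) ≠ 0` has the `K`-types and the invariant products `A D'`, `B C'` of one of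
the six modules `T ∈ {U(0), U(0,±6), Z(±3), W(3,0)}`), `SU21GaugeExistence` (two strongly connected data with
the same `K`-types, a common vertex, square-complete `K`-type set and the same products are isomorphic) and
`SU21Irreducible` (the six model modules are irreducible).

**Statement proved** (`exists_equiv_model_of_isIrreducible`): if `𝒟.V` is an irreducible `𝔤𝔩(3,ℂ)`-module with
`dim H^q(𝔤𝔩₃, 𝔨; 𝒟.V) ≠ 0` for some `q`, then `𝒟.V ≃ₗ⁅ℂ, 𝔤𝔩(3,ℂ)⁆ T.V` for (exactly) one
`T ∈ {trivialMod, holDS, antiholDS, ladderPlus, ladderMinus, midDS}` = `{J_{0,0}, D₂, D₀, J_{1,0}, J_{0,1}, D₁}`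
— [BorelWallach2000, VI Thm 4.11 (1)] "`H^*(𝔤,K;V) ≠ 0 ⇒ V ∈ Π^ρ(G)`" with `Π^ρ(SU(2,1))` the six modules of
VI 4.8, for Kovačević `K`-type data, up to isomorphism.  The `K`-type sets of the six modules (a point, four
rays, a quadrant) are square-complete and have the listed vertices (§1).

## References

* A. Borel, N. Wallach (2000), VI 4.8 p. 131, Thm 4.11 (1) p. 132. [BorelWallach2000]
* D. Kovačević, *Unitary `(𝔤,K)` modules of `SU(2,1)`*, Acta Math. Spalatensia 1 (2021) 105–125
  (arXiv:1810.01752): §3 Thm 2, Remark 3, §4 Thm 5. [Kovacevic2021]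
-/

noncomputable section

open Module
open Literature.Algebra.Lie Literature.Algebra.Lie.ChevalleyEilenberg

namespace Literature.RepresentationTheory.Kovacevic2021

-- Mathlib idiom (Mathlib/Algebra/Lie/OfAssociative.lean): commutator brackets on associative algebras; needed for
-- the `𝔤𝔩(3,ℂ)`-module structure on `𝒟.V`, as in every file of this directory.
attribute [local instance 100] LieRing.ofAssociativeRing

namespace SU21Datum

/-! ## §1 The six `K`-type sets are square-complete -/

/-- a point and the four rays contain no two `K`-types `(n, m-3)`, `(n, m+3)` on one level, so they are
square-complete vacuously [cite: Kovacevic2021, §4] -/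
theorem squareComplete_five :
    (∀ n m : ℤ, (n, m - 3) ∈ trivialMod.S → (n, m + 3) ∈ trivialMod.S → (n + 1, m) ∈ trivialMod.S →
      (n - 1, m) ∈ trivialMod.S) ∧
    (∀ n m : ℤ, (n, m - 3) ∈ holDS.S → (n, m + 3) ∈ holDS.S → (n + 1, m) ∈ holDS.S → (n - 1, m) ∈ holDS.S) ∧
    (∀ n m : ℤ, (n, m - 3) ∈ antiholDS.S → (n, m + 3) ∈ antiholDS.S → (n + 1, m) ∈ antiholDS.S →
      (n - 1, m) ∈ antiholDS.S) ∧
    (∀ n m : ℤ, (n, m - 3) ∈ ladderPlus.S → (n, m + 3) ∈ ladderPlus.S → (n + 1, m) ∈ ladderPlus.S →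
      (n - 1, m) ∈ ladderPlus.S) ∧
    (∀ n m : ℤ, (n, m - 3) ∈ ladderMinus.S → (n, m + 3) ∈ ladderMinus.S → (n + 1, m) ∈ ladderMinus.S →
      (n - 1, m) ∈ ladderMinus.S) := by
  refine ⟨fun n m h1 h2 _ => ?_, fun n m h1 h2 _ => ?_, fun n m h1 h2 _ => ?_, fun n m h1 h2 _ => ?_,
    fun n m h1 h2 _ => ?_⟩
  · simp only [trivialMod, Set.mem_singleton_iff, Prod.mk.injEq] at h1 h2; omega
  · rw [mem_holDS] at h1 h2; omega
  · rw [mem_antiholDS] at h1 h2; omega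
  · rw [mem_ladderPlus] at h1 h2; omega
  · rw [mem_ladderMinus] at h1 h2; omega

/-- the quadrant `{V_{3+p+q, 3p-3q}}` of `W(3,0)` is square-complete: if the cone points `(p, q)` with `q ≥ 1`
and `(p+1, q-1)` are present, so is `(p, q-1)` [cite: Kovacevic2021, §4 (`W(r,s)`)] -/
theorem squareComplete_midDS (n m : ℤ) (h1 : (n, m - 3) ∈ midDS.S) (h2 : (n, m + 3) ∈ midDS.S)
    (_h3 : (n + 1, m) ∈ midDS.S) : (n - 1, m) ∈ midDS.S := by
  obtain ⟨p, q, hn, hm⟩ := h1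
  obtain ⟨p', q', hn', hm'⟩ := h2
  change n = 3 + p + q at hn
  change m - 3 = 3 * p - 3 * q at hm
  change n = 3 + p' + q' at hn'
  change m + 3 = 3 * p' - 3 * q' at hm'
  obtain ⟨q₁, rfl⟩ : ∃ q₁, q = q₁ + 1 := ⟨q - 1, by omega⟩
  exact ⟨p, q₁, by change n - 1 = 3 + p + q₁; omega, by change m = 3 * p - 3 * q₁; omega⟩

variable (𝒟 : SU21Datum)

/-! ## §2 The isomorphism with the model -/

/-- **Borel–Wallach VI Thm 4.11 (1) for `SU(2,1)`, datum form, up to isomorphism.** If `𝒟.V` is an irreducible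
`𝔤𝔩(3,ℂ)`-module with `dim H^q(𝔤𝔩₃, 𝔨; V) ≠ 0` for some `q`, then `𝒟.V` is isomorphic, as a `𝔤𝔩(3,ℂ)`-module,
to one of `U(0) = J_{0,0}`, `U(0,6) = D₂`, `U(0,-6) = D₀`, `Z(3) = J_{1,0}`, `Z(-3) = J_{0,1}`, `W(3,0) = D₁`
(the one with the same `K`-types).
[cite: BorelWallach2000, VI 4.8 p. 131, Thm 4.11 (1) p. 132] [cite: Kovacevic2021, §3 Thm 2, §4 Thm 5] -/
theorem exists_equiv_model_of_isIrreducible [LieModule.IsIrreducible ℂ gl3 𝒟.V] {q : ℕ}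
    (hq : finrank ℂ (relCohomology ℂ gl3 𝒟.V kSub q) ≠ 0) :
    ∃ T : SU21Datum, (T = trivialMod ∨ T = holDS ∨ T = antiholDS ∨ T = ladderPlus ∨
        T = ladderMinus ∨ T = midDS) ∧ 𝒟.S = T.S ∧ Nonempty (𝒟.V ≃ₗ⁅ℂ, gl3⁆ T.V) := by
  obtain ⟨T, hT, hS, hP, hQ⟩ := 𝒟.exists_model_of_isIrreducible hq
  refine ⟨T, hT, hS, ?_⟩
  have hconn : ∀ x ∈ 𝒟.S, ∀ y ∈ 𝒟.S, 𝒟.Reach x y := forall_reach_of_isIrreducible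
  rcases hT with rfl | rfl | rfl | rfl | rfl | rfl
  · haveI := trivialMod_isIrreducible
    exact nonempty_equiv_of_products_eq (x₀ := (1, 0)) hS hconn forall_reach_of_isIrreducible
      (by rw [hS]; exact six_Ktypes.1.1) (by rw [hS]; simp [trivialMod]) (by rw [hS]; simp [trivialMod])
      (by rw [hS]; exact squareComplete_five.1) hP hQ
  · haveI := holDS_isIrreducible
    exact nonempty_equiv_of_products_eq (x₀ := (1, 6)) hS hconn forall_reach_of_isIrreducible
      (by rw [hS]; exact six_Ktypes₂.2.1.1) (by rw [hS, mem_holDS]; norm_num) (by rw [hS, mem_holDS]; norm_num)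
      (by rw [hS]; exact squareComplete_five.2.1) hP hQ
  · haveI := antiholDS_isIrreducible
    exact nonempty_equiv_of_products_eq (x₀ := (1, -6)) hS hconn forall_reach_of_isIrreducible
      (by rw [hS]; exact six_Ktypes₂.2.2.1.2.2) (by rw [hS, mem_antiholDS]; norm_num)
      (by rw [hS, mem_antiholDS]; norm_num) (by rw [hS]; exact squareComplete_five.2.2.1) hP hQ
  · haveI := ladderPlus_isIrreducible
    exact nonempty_equiv_of_products_eq (x₀ := (2, 3)) hS hconn forall_reach_of_isIrreducible
      (by rw [hS]; exact six_Ktypes.2.2.2.2.1.2.1) (by rw [hS, mem_ladderPlus]; norm_num)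
      (by rw [hS, mem_ladderPlus]; norm_num) (by rw [hS]; exact squareComplete_five.2.2.2.1) hP hQ
  · haveI := ladderMinus_isIrreducible
    exact nonempty_equiv_of_products_eq (x₀ := (2, -3)) hS hconn forall_reach_of_isIrreducible
      (by rw [hS]; exact six_Ktypes.2.2.2.2.2.2.2) (by rw [hS, mem_ladderMinus]; norm_num)
      (by rw [hS, mem_ladderMinus]; norm_num) (by rw [hS]; exact squareComplete_five.2.2.2.2) hP hQ
  · haveI := midDS_isIrreducible
    exact nonempty_equiv_of_products_eq (x₀ := (3, 0)) hS hconn forall_reach_of_isIrreducible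
      (by rw [hS]; exact six_Ktypes₂.2.2.2.1.2.1)
      (by rw [hS]; rintro ⟨p, q, h1, -⟩; change (3 : ℤ) - 1 = 3 + p + q at h1; omega)
      (by rw [hS]; rintro ⟨p, q, h1, -⟩; change (3 : ℤ) - 1 = 3 + p + q at h1; omega)
      (by rw [hS]; exact squareComplete_midDS) hP hQ

end SU21Datum

end Literature.RepresentationTheory.Kovacevic2021
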